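import Summits.NavierStokesRegularity.NavierStokesRegularity.Theorems.FilamentSkeletonRssDefectColumnGateVorticityAdjointCutoff

/-!
# Route `FilamentSkeletonRss` · negative item `NoExactProfileNearSymmetricPair` (stmt-NavierStokesRegularity-24091) — S_γ groundwork (B5):
# the layer-flux identity for an ARBITRARY test field (the adjoint residual as a bulk source)

Helper file (theorems only), `--supports stmt-NavierStokesRegularity-24091 --as helper`; LEAD of 23611 / registrar of 23920, lane ns-filament-21221-p1 g15.

WHY.  `flux_balance_of_exact_profile` (p695487) needs an EXACT adjoint solution `𝒯_U^*Ψ = 0` on the support of the cut-off — through the cores, where `DU ~ Γ`; no such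
`Ψ` is in hand.  What IS in hand is the free committor `Ψ₀ = ψe₃` (brick (B2), `…NoExactProfileFreeCommittor`), an exact solution of the FREE adjoint equation whose
residual at a general `U` is the bare coupling `−DΨ₀[U] − (DU)†Ψ₀`.  The identity below keeps the residual as a BULK SOURCE instead of assuming it away:
for an exact profile `U` (`E_α(U) + ∇P = 0`), ANY `Ψ ∈ C²` and ANY compactly supported `χ ∈ C²`,
  `∫ ⟪(Dχ[v] + Δχ)Ψ + 2DΨ[∇χ], curl U⟫ = ∫ χ·⟪𝒯_U^*Ψ, curl U⟫`   (`flux_identity_of_exact_profile_testField`),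
`v = U + ½y − αe₃×y`.  With `Ψ = Ψ₀` the right side is `−∫ χ·(Dψ[U]·Ω₃ + ψ·(Ω·∇)U₃)` (file `…NoExactProfileAxialFluxCommittor`, after (B2) lands): the ψ-weighted
flux of AXIAL vorticity through the cut-off layer equals minus the bulk transport-correction-plus-stretching production of axial vorticity — the (C)-route's
starting identity made explicit, with every term a named kernel object.
HONEST FRAMING: calculus/bookkeeping on the NEGATIVE side of a HYPOTHETICAL filament-type rotating-self-similar blow-up route (MODEL rung); 24091/23611/23920 OPEN;
nothing here bears on Navier–Stokes regularity, which is NOT proved.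
-/

set_option linter.dupNamespace false

noncomputable section

namespace Summit.NavierStokesRegularity.NavierStokesRegularity.Theorems.DefectColumnGate

open scoped BigOperators Topology InnerProductSpace Laplacian ContDiff
open Set Function MeasureTheory
open Literature.Analysis.FluidPDE
open Summit.NavierStokesRegularity.NavierStokesRegularity.Theorems.KelvinGate

/-- Continuity of the formal adjoint `y ↦ 𝒯_U^*Ψ(y)` for `U ∈ C²`, `Ψ ∈ C²`. -/
theorem continuous_vorticityAdjoint (α : ℝ) {U Ψ : EuclideanSpace ℝ (Fin 3) → EuclideanSpace ℝ (Fin 3)} (hU : ContDiff ℝ 2 U) (hΨ : ContDiff ℝ 2 Ψ) :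
    Continuous fun y => -(α • (cross (EuclideanSpace.single 2 1) (Ψ y) - fderiv ℝ Ψ y (cross (EuclideanSpace.single 2 1) y))) - (1/2:ℝ) • Ψ y
        - (1/2:ℝ) • fderiv ℝ Ψ y y - (Δ Ψ) y - fderiv ℝ Ψ y (U y) - ContinuousLinearMap.adjoint (fderiv ℝ U y) (Ψ y) := by
  have hΨc : Continuous Ψ := hΨ.continuous
  have hUc : Continuous U := hU.continuous
  have hDΨ : Continuous (fderiv ℝ Ψ) := hΨ.continuous_fderiv (by norm_num)
  have hDU : Continuous (fderiv ℝ U) := hU.continuous_fderiv (by norm_num)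
  have hΔ : Continuous (Δ Ψ) := continuous_laplacian hΨ
  have h5 : Continuous fun y => ContinuousLinearMap.adjoint (fderiv ℝ U y) :=
    (ContinuousLinearMap.adjoint : (EuclideanSpace ℝ (Fin 3) →L[ℝ] EuclideanSpace ℝ (Fin 3)) ≃ₗᵢ⋆[ℝ]
      (EuclideanSpace ℝ (Fin 3) →L[ℝ] EuclideanSpace ℝ (Fin 3))).continuous.comp hDU
  simp only [cross_single_two_eq_rotGenL]
  fun_prop

/-- **LAYER-FLUX IDENTITY FOR AN ARBITRARY TEST FIELD.**  Let `U ∈ C³` be solenoidal with `E_α(U) + ∇P = 0` pointwise (`P ∈ C²`), let `Ψ ∈ C²` be ANY field and `χ ∈ C²`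
compactly supported.  Then the flux of `curl U` through the cut-off layer against `Ψ` equals the bulk pairing of `curl U` with the adjoint residual of `Ψ`:
`∫ ⟪(Dχ[U + ½y − αe₃×y] + Δχ)·Ψ + 2·DΨ[∇χ], curl U⟫ = ∫ χ·⟪𝒯_U^*Ψ, curl U⟫`.
(`flux_balance_of_exact_profile` is the case `𝒯_U^*Ψ = 0`.) -/
theorem flux_identity_of_exact_profile_testField (α : ℝ) {U Ψ : EuclideanSpace ℝ (Fin 3) → EuclideanSpace ℝ (Fin 3)} {P χ : EuclideanSpace ℝ (Fin 3) → ℝ}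
    (hU : ContDiff ℝ 3 U) (hdiv : VectorCalculus.IsDivFree U) (hP : ContDiff ℝ 2 P)
    (hprof : ∀ y, lerayOp α U y + gradient P y = 0)
    (hΨ : ContDiff ℝ 2 Ψ) (hχ : ContDiff ℝ 2 χ) (hχc : HasCompactSupport χ) :
    ∫ y, ⟪(fderiv ℝ χ y (U y + (1/2:ℝ) • y - α • cross (EuclideanSpace.single 2 1) y) + (Δ χ) y) • Ψ y + (2:ℝ) • fderiv ℝ Ψ y (gradient χ y), curl U y⟫_ℝ
      = ∫ y, χ y * ⟪-(α • (cross (EuclideanSpace.single 2 1) (Ψ y) - fderiv ℝ Ψ y (cross (EuclideanSpace.single 2 1) y))) - (1/2:ℝ) • Ψ y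
          - (1/2:ℝ) • fderiv ℝ Ψ y y - (Δ Ψ) y - fderiv ℝ Ψ y (U y) - ContinuousLinearMap.adjoint (fderiv ℝ U y) (Ψ y), curl U y⟫_ℝ := by
  have hU2 : ContDiff ℝ 2 U := hU.of_le (by norm_num)
  have hΩ : ContDiff ℝ 2 (curl U) := contDiff_curl (n := 2) (by exact_mod_cast hU)
  -- the vorticity solves `𝒯_U Ω = 0`
  have hvort : ∀ y, α • (cross (EuclideanSpace.single 2 1) (curl U y) - fderiv ℝ (curl U) y (cross (EuclideanSpace.single 2 1) y)) + curl U y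
      + (1/2:ℝ) • fderiv ℝ (curl U) y y - (Δ (curl U)) y + fderiv ℝ (curl U) y (U y) - fderiv ℝ U y (curl U y) = 0 := by
    intro y
    have h1 := curl_lerayOp_of_isDivFree α hU hdiv y
    have h2 : curl (lerayOp α U) y = 0 := by
      have e : lerayOp α U = fun z => -(gradient P z) := by
        funext z; have := hprof z; exact eq_neg_of_add_eq_zero_left this
      rw [e]
      have hg := curl_gradient_eq_zero_holds P hP y
      rw [curl_eq_curlCLM] at hg ⊢
      rw [fderiv_fun_neg, map_neg, hg, neg_zero]
    rw [h2, ← add_sub_assoc] at h1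
    exact h1.symm
  -- the test field `χΨ`
  have hT : ContDiff ℝ 2 (fun z => χ z • Ψ z) := hχ.smul hΨ
  have hTc : HasCompactSupport (fun z => χ z • Ψ z) := hχc.smul_right
  have hI := integral_vorticity_adjoint α hU2 hΩ hT hTc hdiv
  have hL0 : ∫ y, ⟪χ y • Ψ y, α • (cross (EuclideanSpace.single 2 1) (curl U y) - fderiv ℝ (curl U) y (cross (EuclideanSpace.single 2 1) y)) + curl U y
      + (1/2:ℝ) • fderiv ℝ (curl U) y y - (Δ (curl U)) y + fderiv ℝ (curl U) y (U y) - fderiv ℝ U y (curl U y)⟫_ℝ = 0 := by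
    simp only [hvort, inner_zero_right, integral_zero]
  rw [hL0] at hI
  -- pointwise: `⟪𝒯^*(χΨ), Ω⟫ = χ⟪𝒯^*Ψ, Ω⟫ − ⟪layer density, Ω⟫`
  have hR : ∀ y, ⟪-(α • (cross (EuclideanSpace.single 2 1) (χ y • Ψ y) - fderiv ℝ (fun z => χ z • Ψ z) y (cross (EuclideanSpace.single 2 1) y)))
        - (1/2:ℝ) • (χ y • Ψ y) - (1/2:ℝ) • fderiv ℝ (fun z => χ z • Ψ z) y y - (Δ (fun z => χ z • Ψ z)) y
        - fderiv ℝ (fun z => χ z • Ψ z) y (U y) - ContinuousLinearMap.adjoint (fderiv ℝ U y) (χ y • Ψ y), curl U y⟫_ℝ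
      = χ y * ⟪-(α • (cross (EuclideanSpace.single 2 1) (Ψ y) - fderiv ℝ Ψ y (cross (EuclideanSpace.single 2 1) y))) - (1/2:ℝ) • Ψ y
          - (1/2:ℝ) • fderiv ℝ Ψ y y - (Δ Ψ) y - fderiv ℝ Ψ y (U y) - ContinuousLinearMap.adjoint (fderiv ℝ U y) (Ψ y), curl U y⟫_ℝ
        - ⟪(fderiv ℝ χ y (U y + (1/2:ℝ) • y - α • cross (EuclideanSpace.single 2 1) y) + (Δ χ) y) • Ψ y + (2:ℝ) • fderiv ℝ Ψ y (gradient χ y), curl U y⟫_ℝ := by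
    intro y
    rw [vorticityAdjoint_smul α U Ψ χ hχ hΨ y]
    simp only [inner_sub_left, inner_add_left, inner_smul_left, RCLike.conj_to_real]
    ring
  simp only [hR] at hI
  -- split the integral: both pieces are continuous with compact support
  have hχ0 : Continuous χ := hχ.continuous
  have hΩc : Continuous (curl U) := hΩ.continuous
  have hAdj := continuous_vorticityAdjoint α hU2 hΨ
  have hcA : Continuous fun y => χ y * ⟪-(α • (cross (EuclideanSpace.single 2 1) (Ψ y) - fderiv ℝ Ψ y (cross (EuclideanSpace.single 2 1) y))) - (1/2:ℝ) • Ψ y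
      - (1/2:ℝ) • fderiv ℝ Ψ y y - (Δ Ψ) y - fderiv ℝ Ψ y (U y) - ContinuousLinearMap.adjoint (fderiv ℝ U y) (Ψ y), curl U y⟫_ℝ := by
    fun_prop
  have hcAs : HasCompactSupport fun y => χ y * ⟪-(α • (cross (EuclideanSpace.single 2 1) (Ψ y) - fderiv ℝ Ψ y (cross (EuclideanSpace.single 2 1) y))) - (1/2:ℝ) • Ψ y
      - (1/2:ℝ) • fderiv ℝ Ψ y y - (Δ Ψ) y - fderiv ℝ Ψ y (U y) - ContinuousLinearMap.adjoint (fderiv ℝ U y) (Ψ y), curl U y⟫_ℝ :=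
    hχc.mul_right
  have hχ1 : Continuous (fderiv ℝ χ) := hχ.continuous_fderiv (by norm_num)
  have hgradc : Continuous (gradient χ) := by
    have : gradient χ = fun y => (InnerProductSpace.toDual ℝ (EuclideanSpace ℝ (Fin 3))).symm (fderiv ℝ χ y) := rfl
    rw [this]; exact (InnerProductSpace.toDual ℝ (EuclideanSpace ℝ (Fin 3))).symm.continuous.comp hχ1
  have hUc : Continuous U := hU.continuous
  have hΨc : Continuous Ψ := hΨ.continuous
  have hDΨ : Continuous (fderiv ℝ Ψ) := hΨ.continuous_fderiv (by norm_num)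
  have hΔχ : Continuous (Δ χ) := continuous_laplacian hχ
  have hcB : Continuous fun y => ⟪(fderiv ℝ χ y (U y + (1/2:ℝ) • y - α • cross (EuclideanSpace.single 2 1) y) + (Δ χ) y) • Ψ y
      + (2:ℝ) • fderiv ℝ Ψ y (gradient χ y), curl U y⟫_ℝ := by
    simp only [cross_single_two_eq_rotGenL]
    fun_prop
  -- the layer density is supported in `tsupport χ`
  have hcBs : HasCompactSupport fun y => ⟪(fderiv ℝ χ y (U y + (1/2:ℝ) • y - α • cross (EuclideanSpace.single 2 1) y) + (Δ χ) y) • Ψ y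
      + (2:ℝ) • fderiv ℝ Ψ y (gradient χ y), curl U y⟫_ℝ := by
    apply HasCompactSupport.intro' (K := tsupport χ) hχc (isClosed_tsupport χ)
    intro y hy
    have h0 : fderiv ℝ χ y = 0 := by
      have : y ∉ tsupport (fderiv ℝ χ) := fun h => hy (tsupport_fderiv_subset ℝ h)
      exact image_eq_zero_of_notMem_tsupport this
    have hg : gradient χ y = 0 := by rw [gradient, h0, map_zero]
    have h2 : (Δ χ) y = 0 := laplacian_eq_zero_of_notMem_tsupport hy
    rw [h0, hg, h2]
    simp
  have hsplit := integral_sub (μ := (volume : Measure (EuclideanSpace ℝ (Fin 3))))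
    (hcA.integrable_of_hasCompactSupport hcAs) (hcB.integrable_of_hasCompactSupport hcBs)
  rw [hsplit] at hI
  linarith

end Summit.NavierStokesRegularity.NavierStokesRegularity.Theorems.DefectColumnGate

end
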